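import Literature.NumberTheory.EllipticCurves.LiLiuTian2024.CongruentNumberRedeiFamilies
import Literature.NumberTheory.QuadraticFields.AmbiguousClasses
import Literature.NumberTheory.QuadraticFields.QuadraticNormForm
import Literature.NumberTheory.EllipticCurves.TianYuanZhang2017.GenusPeriodsParity
import Literature.NumberTheory.NumberFields.NarrowClassGroupCounting
import HarnessLib

/-!
# Route `PrintCf2`, crux stmt-BirchSwinnertonDyer-20509 `RamifiedOffTYZOfFacts`, THEOREM A's target (T3): the arithmetic of `K = ℚ(√−lq)` on R2 rows
# (`l ≡ 1`, `q ≡ 7 (mod 8)`, `(l/q) = 1`) — `#Cl[2] = 2`, `#(Cl² ∩ Cl[2]) = 2`, `#Cl = 2·g`, `g = #Cl²` even, and the ambiguous ideal `𝔭 = (l, √−lq)`: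
# `𝔭² = (l)`, `𝔭` not principal
# (cell `bsd-print-cf2`, LEAD cruxlead-20509 g33, line `offtyz-v7`, lineage cycle 34; Theses-free, `def`-free; §2 is modulo conjunct 7 of 𝔅_ram)

HONEST FRAMING (`--supports stmt-BirchSwinnertonDyer-20509`; theorems only, no `sorry`, no new named fact).  BSD is not proved by any of this;
no class is closed by this file; item 23431 (C⁺) and crux 20509 stay OPEN.  These are the arithmetic inputs of the group-theoretic global half of
(T3) (`TheoremAOrderTwoGroup.pow_smul_eq_self_of_smul_eq`: hypotheses `#A[2] = 2`, `#A = 2m` with `m` even, a lift `p` of the ambiguous class with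
`p²` explicit):

* §1 `redeiMatrix_l_q` — the Rédei matrix of `ℚ(√−lq)` on the tuple `(l, q)` is ZERO when `(l/q) = 1` (entries `[(−q/l) = −1]`, `[(l/q) = −1]`;
  `(−q/l) = (q/l) = (l/q)` by reciprocity, `l ≡ 1 (mod 4)`), so its kernel has `4` elements; `redei_side_conditions_l_q`;
* §2 (modulo Rédei–Reichardt = conjunct 7 of 𝔅_ram) `fourTwoCard_eq_two_l_q` — `#(Cl² ∩ Cl[2]) = 2` for every `K` quadratic of `√−lq`;
  unconditionally `card_sq_eq_one_eq_two` — **`#Cl(K)[2] = 2`** (Gauss, tree `Quadratic.card_sq_eq_one_classGroup`: `d_K = −lq` has two prime factors);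
  ★ `card_classGroup_eq_two_mul_genusClassNumber` — `#Cl(K) = 2 · g(K)`, `g(K) = #Cl² = genusClassNumber K`; `even_genusClassNumber` — `g(K)` is EVEN
  (the non-trivial element of `Cl[2]` is a square, so `Cl²` has even order) — i.e. `4 ∣ h(−lq)`;
* §3 ★ `span_pair_sq_eq_span` — for `λ ∈ 𝓞 K` with `λ² = −lq`: `(l, λ)² = (l)`; `absNorm_span_pair` — `N((l, λ)) = l`;
  ★ `not_isPrincipal_span_pair` — `(l, λ)` is NOT principal (a generator would have norm `l = x² + xy + ((1+lq)/4)y²`, i.e. `4l = (2x+y)² + lq·y²`,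
  impossible as `q > 4` and `l` is prime): its class is the non-trivial element of `Cl(K)[2]`.

References: [cite: LiMa2008, Thm. 0.4]; [cite: RedeiReichardt1934]; [cite: Cox2013, §3.B Thm. 3.15, §6.A Thm. 6.1, §7.B Thm. 7.7];
[cite: TianYuanZhang2017, §1 (g(n) = #2Cl)]; LEAD g29 memo `Lines/offtyz_v7_ExactDescent.md` §2c; tree p812177 (local half), `TheoremAOrderTwoGroup`.
-/

noncomputable section

open scoped Classical
open Matrix NumberField

namespace Summit.BirchSwinnertonDyer.PrintCf2.TheoremAAmbiguous

open Literature.NumberTheory.EllipticCurves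
open Literature.NumberTheory.EllipticCurves.Tian2014 (IsQuadraticFieldOfSqrt fourTwoCard)
open Literature.NumberTheory.QuadraticFields.RedeiReichardt Literature.NumberTheory.EllipticCurves.LiLiuTian2024.RedeiFamilies
open Literature.NumberTheory.QuadraticFields.Quadratic Literature.NumberTheory.QuadraticFields.BinaryQuadraticForm
open Literature.NumberTheory.EllipticCurves.TianYuanZhang2017 (genusClassNumber)
open Literature.NumberTheory.NumberFields

variable {l q : ℕ}

/-! ## §1 The Rédei matrix of `ℚ(√−lq)` -/

/-- `(l/q) = 1` as a Jacobi symbol from `l` a non-zero square modulo the prime `q`. [folklore] -/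
theorem jacobiSym_eq_one_of_isSquare (hl : l.Prime) (hq : q.Prime) (hlq : l ≠ q) (hsq : IsSquare ((l : ℤ) : ZMod q)) :
    jacobiSym (l : ℤ) q = 1 := by
  haveI : Fact q.Prime := ⟨hq⟩
  have hne : ((l : ℤ) : ZMod q) ≠ 0 := natCast_ne_zero_of_prime_ne hq hl hlq
  rw [← jacobiSym.legendreSym.to_jacobiSym, legendreSym.eq_one_iff q hne]
  exact hsq

/-- The prime discriminants of `D = −lq` (`l ≡ 1`, `q ≡ 3 (mod 4)`): `D_l = l`, `D_q = −q`. [cite: LiMa2008, Lemma 0.1 (p. 279)] -/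
theorem primeDisc_l_q (hl4 : l % 4 = 1) (hq4 : q % 4 = 3) :
    primeDisc (l * q) l = l ∧ primeDisc (l * q) q = -(q : ℤ) := by
  refine ⟨?_, ?_⟩
  · rw [primeDisc_of_ne_two _ (by omega), if_pos hl4]
  · rw [primeDisc_of_ne_two _ (by omega), if_neg (by omega)]

/-- ★ **`RM(−lq) = 0` when `(l/q) = 1`** (`l ≡ 1 (mod 4)`, `q ≡ 3 (mod 4)` primes): the off-diagonal entries are `[(−q/l) = −1]` and `[(l/q) = −1]`,
and `(−q/l) = (−1/l)(q/l) = (q/l) = (l/q) = 1`. [cite: LiMa2008, Def. 0.2 and Thm. 0.4 (pp. 279–280); evaluation ours]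
[cite: IrelandRosen1990, Ch. 5 §2 Thm. 2 (reciprocity)] -/
theorem redeiMatrix_l_q (hl : l.Prime) (hq : q.Prime) (hl4 : l % 4 = 1) (hq4 : q % 4 = 3) (hlq : jacobiSym (l : ℤ) q = 1) :
    redeiMatrix (l * q) ![l, q] = 0 := by
  obtain ⟨dl, dq⟩ := primeDisc_l_q hl4 hq4
  have hne : l ≠ q := by omega
  have hql : jacobiSym (q : ℤ) l = 1 := by
    have h := hlq
    rwa [jacobiSym.quadratic_reciprocity_one_mod_four hl4 (Nat.odd_iff.mpr (by omega))] at h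
  have hm1 : jacobiSym (-1 : ℤ) l = 1 := by
    rw [jacobiSym.at_neg_one (Nat.odd_iff.mpr (by omega)), ZMod.χ₄_nat_one_mod_four hl4]
  have hnegq : jacobiSym (-(q : ℤ)) l = 1 := by
    rw [neg_eq_neg_one_mul, jacobiSym.mul_left, hm1, hql, one_mul]
  have e01 : kroneckerBit (-(q : ℤ)) l = 0 := by
    refine (kroneckerBit_eq_zero_iff_jacobiSym hl (by omega) ?_).mpr hnegq
    rw [Int.cast_neg, neg_ne_zero]
    exact natCast_ne_zero_of_prime_ne hl hq hne.symm
  have e10 : kroneckerBit (l : ℤ) q = 0 :=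
    (kroneckerBit_eq_zero_iff_jacobiSym hq (by omega) (natCast_ne_zero_of_prime_ne hq hl hne)).mpr hlq
  ext i j
  fin_cases i <;> fin_cases j <;>
    simp [redeiMatrix, Finset.sum_erase_eq_sub, Fin.sum_univ_two, dl, dq, e01, e10]

/-- Kernel count `4` (`rank RM = 0`, `r₄ = 1`). [cite: LiMa2008, Thm. 0.4 (p. 280)] -/
theorem card_ker_redeiMatrix_l_q (hl : l.Prime) (hq : q.Prime) (hl4 : l % 4 = 1) (hq4 : q % 4 = 3) (hlq : jacobiSym (l : ℤ) q = 1) :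
    Fintype.card {v : Fin 2 → ZMod 2 // redeiMatrix (l * q) ![l, q] *ᵥ v = 0} = 4 := by
  have hM := redeiMatrix_l_q hl hq hl4 hq4 hlq
  rw [Fintype.card_congr (Equiv.subtypeEquivRight (q := fun v : Fin 2 → ZMod 2 => (0 : Matrix (Fin 2) (Fin 2) (ZMod 2)) *ᵥ v = 0)
    (fun v => by rw [hM]))]
  decide

/-- The side conditions of the Rédei door for the tuple `(l, q)`: primes, injective, `∏ = lq` with `lq ≡ 3 (mod 4)`.
[cite: LiMa2008, Lemma 0.1 (p. 279)] -/
theorem redei_side_conditions_l_q (hl : l.Prime) (hq : q.Prime) (hl4 : l % 4 = 1) (hq4 : q % 4 = 3) :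
    (∀ i, ((![l, q] : Fin 2 → ℕ) i).Prime) ∧ Function.Injective (![l, q] : Fin 2 → ℕ) ∧
      (∏ i, (![l, q] : Fin 2 → ℕ) i) = if (l * q) % 4 = 1 then 2 * (l * q) else l * q := by
  have h4 : l * q % 4 = 3 := by rw [Nat.mul_mod, hl4, hq4]
  refine ⟨?_, ?_, ?_⟩
  · intro i; fin_cases i
    · exact hl
    · exact hq
  · intro i j h
    have : l ≠ q := by omega
    fin_cases i <;> fin_cases j <;> simp_all
  · rw [if_neg (by omega), Fin.prod_univ_two]; rfl

/-! ## §2 `#(Cl² ∩ Cl[2]) = 2`, `#Cl[2] = 2`, `#Cl = 2g` with `g` even -/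

/-- **`#(Cl(K)² ∩ Cl(K)[2]) = 2`** (4-rank one) for `K` quadratic of `√−lq`, `l ≡ 1 (mod 4)`, `q ≡ 3 (mod 4)`, `(l/q) = 1` — MODULO Rédei–Reichardt
(conjunct 7 of 𝔅_ram). [cite: LiMa2008, Thm. 0.4 (p. 280)] [cite: RedeiReichardt1934, Satz] -/
theorem fourTwoCard_eq_two_l_q (h : redeiReichardt_fourTwoCard_classGroup) (hl : l.Prime) (hq : q.Prime) (hl4 : l % 4 = 1) (hq4 : q % 4 = 3)
    (hlq : jacobiSym (l : ℤ) q = 1) (K : Type) [Field K] [NumberField K] (hK : IsQuadraticFieldOfSqrt K (-((l * q : ℕ) : ℤ))) :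
    fourTwoCard (ClassGroup (𝓞 K)) = 2 := by
  obtain ⟨hpr, hinj, hprod⟩ := redei_side_conditions_l_q hl hq hl4 hq4
  exact fourTwoCard_eq_of_card_ker h hpr hinj hprod (e := 1) (by rw [card_ker_redeiMatrix_l_q hl hq hl4 hq4 hlq]; rfl) K hK

variable {K : Type} [Field K] [NumberField K]

/-- **`#Cl(K)[2] = 2`** for `K` imaginary quadratic with `d_K = −lq`, `l ≠ q` primes (Gauss: `2^{t−1}` with `t = 2`). UNCONDITIONAL.
[cite: Cox2013, §3.B Thm. 3.15 and §6.A Thm. 6.1] -/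
theorem card_sq_eq_one_eq_two (hK : IsImaginaryQuadratic K) (hl : l.Prime) (hq : q.Prime) (hlq : l ≠ q)
    (hd : NumberField.discr K = -((l * q : ℕ) : ℤ)) : Nat.card {c : ClassGroup (𝓞 K) // c ^ 2 = 1} = 2 := by
  have hcop : l.Coprime q := (Nat.coprime_primes hl hq).mpr hlq
  have hdisj : Disjoint l.primeFactors q.primeFactors := by
    rw [hl.primeFactors, hq.primeFactors, Finset.disjoint_singleton]; exact hlq
  rw [card_sq_eq_one_classGroup hK, hd, Int.natAbs_neg, Int.natAbs_natCast, Nat.Coprime.primeFactors_mul hcop,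
    Finset.card_union_of_disjoint hdisj, hl.primeFactors, hq.primeFactors, Finset.card_singleton, Finset.card_singleton]
  norm_num

/-- `#Cl(K)² = g(K)`: the subgroup of squares has `genusClassNumber K` elements. [cite: TianYuanZhang2017, §1 (g = #2Cl)] -/
theorem card_range_sq_eq_genusClassNumber : Nat.card (powMonoidHom (α := ClassGroup (𝓞 K)) 2).range = genusClassNumber K := by
  rw [genusClassNumber]
  refine Nat.card_congr (Equiv.subtypeEquivRight fun c => ?_)
  rw [MonoidHom.mem_range]
  constructor
  · rintro ⟨y, rfl⟩; exact ⟨y, by rw [powMonoidHom_apply, pow_two]⟩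
  · rintro ⟨y, hy⟩; exact ⟨y, by rw [powMonoidHom_apply, pow_two, hy]⟩

/-- `#Cl(K) = [Cl : Cl²] · #Cl² = #Cl[2] · g(K)`. [folklore] [cite: TianYuanZhang2017, §1 (g = #2Cl)] -/
theorem card_classGroup_eq_card_sq_eq_one_mul_genusClassNumber :
    Nat.card (ClassGroup (𝓞 K)) = Nat.card {c : ClassGroup (𝓞 K) // c ^ 2 = 1} * genusClassNumber K := by
  have h1 := (powMonoidHom (α := ClassGroup (𝓞 K)) 2).range.card_mul_index
  rw [index_range_powMonoidHom_eq_card_ker'] at h1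
  have hker : Nat.card (powMonoidHom (α := ClassGroup (𝓞 K)) 2).ker = Nat.card {c : ClassGroup (𝓞 K) // c ^ 2 = 1} :=
    Nat.card_congr (Equiv.subtypeEquivRight fun c => by rw [MonoidHom.mem_ker, powMonoidHom_apply])
  rw [← h1, hker, card_range_sq_eq_genusClassNumber, mul_comm]

/-- ★ **`#Cl(K) = 2 · g(K)`** for `d_K = −lq`. [cite: Cox2013, §6.A Thm. 6.1] [cite: TianYuanZhang2017, §1] -/
theorem card_classGroup_eq_two_mul_genusClassNumber (hK : IsImaginaryQuadratic K) (hl : l.Prime) (hq : q.Prime) (hlq : l ≠ q)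
    (hd : NumberField.discr K = -((l * q : ℕ) : ℤ)) : Nat.card (ClassGroup (𝓞 K)) = 2 * genusClassNumber K := by
  rw [card_classGroup_eq_card_sq_eq_one_mul_genusClassNumber, card_sq_eq_one_eq_two hK hl hq hlq hd]

/-- ★ **`g(K) = #Cl(K)²` is EVEN** (`4 ∣ h(−lq)`) when moreover `(l/q) = 1`, MODULO Rédei–Reichardt: the non-trivial element of `Cl[2]` is then a square
(`#(Cl² ∩ Cl[2]) = 2`), an element of order `2` of `Cl²`. [cite: RedeiReichardt1934, Satz] [cite: LiMa2008, Thm. 0.4] -/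
theorem even_genusClassNumber (h : redeiReichardt_fourTwoCard_classGroup) (hl : l.Prime) (hq : q.Prime) (hl4 : l % 4 = 1) (hq4 : q % 4 = 3)
    (hlq : jacobiSym (l : ℤ) q = 1) (hK : IsQuadraticFieldOfSqrt K (-((l * q : ℕ) : ℤ))) : Even (genusClassNumber K) := by
  have h2 := fourTwoCard_eq_two_l_q h hl hq hl4 hq4 hlq K hK
  rw [fourTwoCard] at h2
  -- a square `c ≠ 1` with `c² = 1`
  obtain ⟨c, hc, -⟩ := (Nat.card_eq_two_iff' (⟨1, ⟨1, by rw [mul_one]⟩, one_pow 2⟩ : {a : ClassGroup (𝓞 K) // IsSquare a ∧ a ^ 2 = 1})).mp h2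
  have hc1 : (c : ClassGroup (𝓞 K)) ≠ 1 := fun e => hc (Subtype.ext e)
  obtain ⟨⟨y, hy⟩, hc2⟩ := c.2
  -- as an element of the subgroup of squares it has order `2`
  let c' : (powMonoidHom (α := ClassGroup (𝓞 K)) 2).range := ⟨c, ⟨y, by rw [powMonoidHom_apply, pow_two, ← hy]⟩⟩
  have hord : orderOf c' = 2 := by
    haveI : Fact (Nat.Prime 2) := ⟨Nat.prime_two⟩
    refine orderOf_eq_prime (Subtype.ext ?_) (fun e => hc1 (congrArg Subtype.val e))
    exact hc2
  have hdvd := orderOf_dvd_natCard c'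
  rw [hord, card_range_sq_eq_genusClassNumber] at hdvd
  exact even_iff_two_dvd.mpr hdvd

/-! ## §3 The ambiguous ideal `𝔭 = (l, √−lq)`: `𝔭² = (l)`, `N𝔭 = l`, `𝔭` not principal -/

/-- ★ **`(l, w)² = (l)`** in any commutative ring, for `w² = −lq` with `gcd(l, q) = 1`: `(l, w)² = (l², lw, w²) = (l², lw, lq) ∋ l = a·l² + b·lq`.
[cite: Cox2013, §5.B Prop. 5.16 (ramified primes) and §7.B Thm. 7.7] -/
theorem span_pair_sq_eq_span {S : Type*} [CommRing S] (hcop : l.Coprime q) (w : S) (hw : w ^ 2 = -((l * q : ℕ) : S)) :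
    (Ideal.span {(l : S), w}) ^ 2 = Ideal.span {(l : S)} := by
  rw [pow_two, Ideal.span_pair_mul_span_pair]
  apply le_antisymm
  · rw [Ideal.span_le]
    intro x hx
    simp only [Set.mem_insert_iff, Set.mem_singleton_iff] at hx
    rw [SetLike.mem_coe, Ideal.mem_span_singleton]
    rcases hx with rfl | rfl | rfl | rfl
    · exact Dvd.intro _ rfl
    · exact Dvd.intro _ rfl
    · exact Dvd.intro_left _ rfl
    · rw [← pow_two, hw, Nat.cast_mul, ← mul_neg]
      exact Dvd.intro _ rfl
  · rw [Ideal.span_singleton_le_iff_mem]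
    obtain ⟨a, b, hab⟩ := Nat.isCoprime_iff_coprime.mpr hcop
    have hl : (l : S) = (a : S) * ((l : S) * l) + (-(b : S)) * (w * w) := by
      rw [← pow_two w, hw]
      have h1 : ((a * l + b * q : ℤ) : S) = 1 := by rw [hab, Int.cast_one]
      push_cast at h1 ⊢
      linear_combination -(l : S) * h1
    have hmem : (a : S) * ((l : S) * l) + (-(b : S)) * (w * w) ∈ Ideal.span {(l : S) * l, (l : S) * w, w * l, w * w} :=
      Ideal.add_mem _ (Ideal.mul_mem_left _ _ (Ideal.subset_span (by simp))) (Ideal.mul_mem_left _ _ (Ideal.subset_span (by simp)))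
    rwa [← hl] at hmem

/-- `N((l, w)) = l` (`N((l,w))² = N((l)) = l²`). [cite: Cox2013, §7.B Thm. 7.7 (N(𝔞) for 𝔞 = [a, (−b+√D)/2])] -/
theorem absNorm_span_pair (hK : IsImaginaryQuadratic K) (hcop : l.Coprime q) (w : 𝓞 K) (hw : w ^ 2 = -((l * q : ℕ) : 𝓞 K)) :
    Ideal.absNorm (Ideal.span {(l : 𝓞 K), w}) = l := by
  have h := congrArg Ideal.absNorm (span_pair_sq_eq_span hcop w hw)
  rw [map_pow, Ideal.absNorm_span_singleton] at h
  have hn : Algebra.norm ℤ ((l : ℕ) : 𝓞 K) = (l : ℤ) ^ 2 := by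
    have h1 := Algebra.norm_algebraMap (S := 𝓞 K) (l : ℤ)
    rw [NumberField.RingOfIntegers.rank, hK.1] at h1
    rw [← h1]; simp
  rw [hn, Int.natAbs_pow, Int.natAbs_natCast] at h
  exact Nat.pow_left_injective two_ne_zero h

/-- ★ **`(l, w)` is NOT principal** (`K` imaginary quadratic with `d_K = −lq`, `l` prime, `q > 4`): a generator `π` would have `N(π) = l`, i.e.
`4l = (2x + By)² + lq·y²` with the principal form `(1, B, C)` of discriminant `−lq` — impossible (`y ≠ 0` gives `> 4l`, `y = 0` gives `l = x²`).  So
`[(l, w)]` is the non-trivial element of `Cl(K)[2]`. [cite: Cox2013, §7.B Thm. 7.7, §2.A (representation by the principal form)] -/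
theorem not_isPrincipal_span_pair (hK : IsImaginaryQuadratic K) (hl : l.Prime) (hq : 4 < q) (hcop : l.Coprime q)
    (hd : NumberField.discr K = -((l * q : ℕ) : ℤ)) (w : 𝓞 K) (hw : w ^ 2 = -((l * q : ℕ) : 𝓞 K)) :
    ¬ (Ideal.span {(l : 𝓞 K), w}).IsPrincipal := by
  rintro ⟨π, hπ⟩
  have hN : Ideal.absNorm (Ideal.span {π}) = l := by
    have h := absNorm_span_pair hK hcop w hw
    rwa [hπ] at h
  obtain ⟨x, y, hxy⟩ := exists_principalForm_eq_absNorm_span hK.1 hK.discr_neg π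
  rw [hN] at hxy
  -- `B² − 4C = d_K = −lq`
  have h4 : NumberField.discr K % 4 = 0 ∨ NumberField.discr K % 4 = 1 := discr_emod_four hK.1
  have hA : (principalForm (NumberField.discr K)).1 = 1 := by
    unfold principalForm; split_ifs <;> rfl
  set B := (principalForm (NumberField.discr K)).2.1 with hB
  set C := (principalForm (NumberField.discr K)).2.2 with hC
  have hdisc : B ^ 2 - 4 * C = -((l * q : ℕ) : ℤ) := by
    have h := discr_principalForm h4
    rw [show discr (principalForm (NumberField.discr K)) = B ^ 2 - 4 * (principalForm (NumberField.discr K)).1 * C from rfl, hA, hd] at h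
    linarith
  -- `4l = (2x + By)² + lq y²`
  have hkey : 4 * (l : ℤ) = (2 * x + B * y) ^ 2 + (l * q : ℕ) * y ^ 2 := by
    push_cast at hdisc hxy ⊢
    linear_combination -4 * hxy - y ^ 2 * hdisc
  have hl0 : (0 : ℤ) < l := by exact_mod_cast hl.pos
  rcases eq_or_ne y 0 with hy | hy
  · -- `l = x²`
    have hx : (l : ℤ) = x ^ 2 := by
      subst hy
      have h' : (4 : ℤ) * l = 4 * x ^ 2 := by linear_combination hkey
      linarith
    have hnat : l = x.natAbs * x.natAbs := by
      have := congrArg Int.natAbs hx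
      rwa [Int.natAbs_natCast, Int.natAbs_pow, pow_two] at this
    rw [hnat] at hl
    rcases Nat.prime_mul_iff.mp hl with ⟨hp, h1⟩ | ⟨hp, h1⟩ <;> exact hp.one_lt.ne' h1
  · have hy2 : (1 : ℤ) ≤ y ^ 2 := by
      have := Int.one_le_abs hy
      nlinarith [sq_abs y]
    have hsq : (0 : ℤ) ≤ (2 * x + B * y) ^ 2 := sq_nonneg _
    have hq' : (4 : ℤ) < q := by exact_mod_cast hq
    have hlq0 : (0 : ℤ) < (l : ℤ) * q := mul_pos hl0 (by linarith)
    have h1 : (l : ℤ) * q * 1 ≤ (l : ℤ) * q * y ^ 2 := mul_le_mul_of_nonneg_left hy2 hlq0.le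
    have h2 : (l : ℤ) * 4 < (l : ℤ) * q := mul_lt_mul_of_pos_left hq' hl0
    push_cast at hkey
    linarith

end Summit.BirchSwinnertonDyer.PrintCf2.TheoremAAmbiguous

end
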